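import Mathlib
import HarnessLib
import Literature.Analysis.FluidPDE.SelfSimilar
import Literature.Analysis.FluidPDE.LocalTypeI
import Literature.Analysis.FluidPDE.VectorCalculus
import Literature.Analysis.FluidPDE.ClassicalSolution
import Literature.Analysis.FluidPDE.TypeIAncientMild
import Literature.Analysis.UnboundedOperators.HeatKernel
import Summits.NavierStokesRegularity.NavierStokesRegularity.Theorems.LocalSineTubeDoorProfileAlignedWindowRigidityAncient
import Summits.NavierStokesRegularity.NavierStokesRegularity.Theorems.PoloidalWindowDoorPoloidalWindowRigidityWindow
import Summits.NavierStokesRegularity.NavierStokesRegularity.Theorems.PoloidalWindowDoorPoloidalWindowRigidityFlat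
import Summits.NavierStokesRegularity.NavierStokesRegularity.Theorems.PoloidalWindowDoorPoloidalWindowRigidityOneSlice
import Summits.NavierStokesRegularity.NavierStokesRegularity.Theorems.PoloidalWindowDoorPoloidalWindowRigidityClassRate
import Summits.NavierStokesRegularity.NavierStokesRegularity.Theorems.PoloidalWindowDoorPoloidalWindowRigidityFirstIntegral
import Summits.NavierStokesRegularity.NavierStokesRegularity.Theorems.PoloidalWindowDoorPoloidalWindowRigidityScrewAssembly
import Summits.NavierStokesRegularity.NavierStokesRegularity.Theorems.PoloidalWindowDoorPoloidalWindowRigidityDecayingSlopeLiouville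
import Summits.NavierStokesRegularity.NavierStokesRegularity.Theorems.PoloidalWindowDoorPoloidalWindowRigidityConstantPressureGradient

/-!
# Route `PoloidalWindowDoor`, crux `PoloidalWindowRigidity` (K2, stmt-NavierStokesRegularity-19708) — the strata
# «ONE HORIZONTAL pressure-gradient component spatially constant» (poloidal) and «TWO components spatially constant»
# (no poloidality) are empty

Cell ns-regularity-ideate, seat ns-poloidal-K2-p3 (stub-worker, gen 2; support theorems `--supports` the crux,
`--as helper`).  Write `f := ∂ₜv + (v·∇)v − Δv` for the INTRINSIC momentum residual of a profile `v` of the route's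
Type-I class (`= −∇p` on every window with a classical pressure; no pressure is named below).  This file completes
the picture begun in this seat's `…VerticalSourceGauge` ((V): `⟪f, e₃⟫` spatially constant on every slice + poloidal
⇒ `v ≡ 0`) and `…ConstantPressureGradient` ((∇p): all of `f` spatially constant ⇒ `v ≡ 0`, no poloidality):

* `eq_zero_of_twoComponentSourceGauge` — **NO poloidality**: if TWO Cartesian components `⟪f, eᵢ⟫`, `⟪f, eⱼ⟫`
  (`i ≠ j`) are spatially constant on every slice, then `v ≡ 0`.  The lead's L4
  (`…DecayingSlopeLiouville.stub_decayingSlopeLiouville`, p457547) makes `vᵢ`, `vⱼ` constant on every slice; then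
  `div v = 0` kills `∂ₖvₖ` for the third index `k`, so ONE slice is invariant under translations along `eₖ`, and
  nsreg-p6's one-slice translate Liouville `…OneSlice.eq_zero_of_translate_eq_slice` ends.  (The affine-pressure
  stratum (∇p) of p462762 is the case of three components.)
* `eq_zero_of_horizontalSourceGauge_single_zero` / `…_single_one` — **WITH poloidality along `e₃`**: if ONE
  HORIZONTAL component `⟪f, e₀⟫` (resp. `⟪f, e₁⟫`) is spatially constant on every slice, then `v ≡ 0`.  L4 makes
  `v₀` constant on slices; then `ω₃ ≡ 0` and the frozen constraint `⟪Dv ω, e₃⟫ ≡ 0` (nsreg-p6 `stub_firstIntegral`)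
  reduce on every slice to the product identity `(∂₃v₁)·(∂₀v₃) ≡ 0`; both factors are real-analytic, so on the slice
  `s = −1` one of them vanishes identically (identity theorem): `∂₀v₃ ≡ 0` is nsreg-p6's flat stratum
  (`eq_zero_of_flat_slice_single_zero`), `∂₃v₁ ≡ 0` together with `∂₃v₀ ≡ 0` is the vertically rigid stratum
  (`eq_zero_of_vertRigid_slice`).

With (V) this gives: **the residue S2′ may assume that EVERY Cartesian component `⟪∇p(t,·), eᵢ⟫` (`i = 0,1,2`) is
spatially non-constant on some slice, and (without using poloidality) that no two of them are spatially constant on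
all slices.**  Mechanism census (for the lead): L4 reaches exactly the time-only sources; the located gap of the line
(sources depending on `(x₃,t)`, i.e. the separated-pressure stratum `∇_h∂₃p ≡ 0`) is untouched here.

WHAT THIS IS NOT: not a claim about Navier–Stokes regularity and not the open residue S2′ — two more settled thin
strata of a door route's Type-I Liouville problem (bears_on LADDER-NS N0, rung N0-LocalTubeDoorPoloidal).
-/

noncomputable section

-- the summit and its single sub-problem share the name (CONVENTIONS §1), as in every Theorems file
set_option linter.dupNamespace false

namespace Summit.NavierStokesRegularity.NavierStokesRegularity.Theorems.PoloidalWindowDoorPoloidalWindowRigidityHorizontalSourceGauge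

open MeasureTheory Set Function Filter Topology TopologicalSpace Metric InnerProductSpace
open scoped RealInnerProductSpace InnerProductSpace Laplacian ContDiff
open Literature.Analysis Literature.Analysis.FluidPDE
open Summit.NavierStokesRegularity.NavierStokesRegularity.Theorems.LocalSineTubeDoorProfileAlignedWindowRigidityAncient
open Summit.NavierStokesRegularity.NavierStokesRegularity.Theorems.PoloidalWindowDoorPoloidalWindowRigidityWindow
open Summit.NavierStokesRegularity.NavierStokesRegularity.Theorems.PoloidalWindowDoorPoloidalWindowRigidityFlat
open Summit.NavierStokesRegularity.NavierStokesRegularity.Theorems.PoloidalWindowDoorPoloidalWindowRigidityOneSlice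
open Summit.NavierStokesRegularity.NavierStokesRegularity.Theorems.PoloidalWindowDoorPoloidalWindowRigidityClassRate
open Summit.NavierStokesRegularity.NavierStokesRegularity.Theorems.PoloidalWindowDoorPoloidalWindowRigidityFirstIntegral
open Summit.NavierStokesRegularity.NavierStokesRegularity.Theorems.PoloidalWindowDoorPoloidalWindowRigidityScrewAssembly
open Summit.NavierStokesRegularity.NavierStokesRegularity.Theorems.PoloidalWindowDoorPoloidalWindowRigidityDecayingSlopeLiouville
open Summit.NavierStokesRegularity.NavierStokesRegularity.Theorems.PoloidalWindowDoorPoloidalWindowRigidityConstantPressureGradient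

variable {C : ℝ} {v : ℝ → EuclideanSpace ℝ (Fin 3) → EuclideanSpace ℝ (Fin 3)}

/-! ### Kinematic lemmas on one slice -/

/-- A `C¹` field on `ℝ³` with `∂ₑ V ≡ 0` is invariant under translations along `e` (mean value theorem on the lines
`l ↦ y + l e`). -/
theorem translate_eq_of_fderiv_eq_zero {V : EuclideanSpace ℝ (Fin 3) → EuclideanSpace ℝ (Fin 3)}
    (hV : Differentiable ℝ V) {e : EuclideanSpace ℝ (Fin 3)} (h : ∀ z, fderiv ℝ V z e = 0)
    (y : EuclideanSpace ℝ (Fin 3)) (l : ℝ) : V (y + l • e) = V y := by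
  have hline : ∀ l : ℝ, HasDerivAt (fun l : ℝ => y + l • e) e l := fun l => by
    simpa using ((hasDerivAt_id l).smul_const e).const_add y
  have hderiv : ∀ l : ℝ, HasDerivAt (fun l : ℝ => V (y + l • e)) 0 l := fun l => by
    have hc := (hV (y + l • e)).hasFDerivAt.comp_hasDerivAt l (hline l)
    rwa [h] at hc
  have hconst := is_const_of_deriv_eq_zero (f := fun l : ℝ => V (y + l • e))
    (fun l => (hderiv l).differentiableAt) (fun l => (hderiv l).deriv) l 0
  simpa using hconst

/-- If the `i`-th Cartesian component of a differentiable field is constant, all its partial derivatives vanish: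
`(DV(y) w)ᵢ = 0`. -/
theorem fderiv_apply_coord_eq_zero_of_const {V : EuclideanSpace ℝ (Fin 3) → EuclideanSpace ℝ (Fin 3)}
    (hV : Differentiable ℝ V) {i : Fin 3} (hc : ∀ y, V y i = V 0 i) (y w : EuclideanSpace ℝ (Fin 3)) :
    fderiv ℝ V y w i = 0 := by
  rw [fderiv_apply_coord (hV y) w i]
  have hfun : (fun z => V z i) = fun _ => V 0 i := funext hc
  rw [hfun, fderiv_fun_const]
  rfl

/-- Index bookkeeping on `Fin 3`: off a third index `k ∉ {i, j}` (`i ≠ j`) every index is `i` or `j`. -/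
theorem fin3_eq_or_eq_of_ne : ∀ i j k m : Fin 3, i ≠ j → k ≠ i → k ≠ j → m ≠ k → m = i ∨ m = j := by decide

/-- Index bookkeeping on `Fin 3`: two distinct indices leave a third. -/
theorem fin3_exists_third : ∀ i j : Fin 3, i ≠ j → ∃ k : Fin 3, k ≠ i ∧ k ≠ j := by decide

/-- **Two constant components + `div V = 0` ⇒ invariance along the third axis.**  If `V ∈ C¹(ℝ³)` is
divergence-free and its components `i ≠ j` are constant, then `∂ₖV ≡ 0` for the remaining index `k`. -/
theorem fderiv_single_eq_zero_of_two_const {V : EuclideanSpace ℝ (Fin 3) → EuclideanSpace ℝ (Fin 3)}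
    (hV : Differentiable ℝ V) (hdiv : VectorCalculus.IsDivFree V) {i j k : Fin 3} (hij : i ≠ j)
    (hki : k ≠ i) (hkj : k ≠ j) (hi : ∀ y, V y i = V 0 i) (hj : ∀ y, V y j = V 0 j)
    (y : EuclideanSpace ℝ (Fin 3)) : fderiv ℝ V y (EuclideanSpace.single k 1) = 0 := by
  -- the diagonal entries `(∂ₘV)ₘ`, `m ≠ k`, vanish
  have hdiag : ∀ m : Fin 3, m ≠ k → fderiv ℝ V y (EuclideanSpace.single m 1) m = 0 := by
    intro m hm
    rcases fin3_eq_or_eq_of_ne i j k m hij hki hkj hm with rfl | rfl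
    · exact fderiv_apply_coord_eq_zero_of_const hV hi y _
    · exact fderiv_apply_coord_eq_zero_of_const hV hj y _
  -- `div V = 0` then kills `(∂ₖV)ₖ`
  have hsum : ∑ m : Fin 3, fderiv ℝ V y (EuclideanSpace.single m 1) m = 0 := by
    have hd := hdiv y
    rw [divergence_eq_sum_inner_fderiv (EuclideanSpace.basisFun (Fin 3) ℝ)] at hd
    simpa only [EuclideanSpace.basisFun_apply, EuclideanSpace.inner_single_left, map_one, one_mul] using hd
  have hkk : fderiv ℝ V y (EuclideanSpace.single k 1) k = 0 := by
    rw [Finset.sum_eq_single k (fun m _ hm => hdiag m hm) (fun h => absurd (Finset.mem_univ k) h)] at hsum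
    exact hsum
  ext m
  by_cases hm : m = k
  · subst hm; simpa using hkk
  · rcases fin3_eq_or_eq_of_ne i j k m hij hki hkj hm with rfl | rfl
    · simpa using fderiv_apply_coord_eq_zero_of_const hV hi y (EuclideanSpace.single k 1)
    · simpa using fderiv_apply_coord_eq_zero_of_const hV hj y (EuclideanSpace.single k 1)

/-! ### L4 for one Cartesian component -/

/-- **One spatially constant component of the residual ⇒ that velocity component is constant on every slice**
(the lead's L4 applied to `θ = ⟪v, eᵢ⟫`: joint `C²`, time-only source, decaying slope `C₁/(−t)`; no poloidality). -/
theorem slice_const_of_componentSourceGauge (hrate : HasTypeITimeDecay C v)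
    (hcont : ContinuousOn (uncurry v) (Iio (0 : ℝ) ×ˢ univ))
    (hmild : ∀ s t : ℝ, s < t → t < 0 → ∀ x,
      v t x = UnboundedOperators.heatExtension (v s) (t - s) x - oseenDuhamel 1 s v v t x)
    (hdiv : ∀ t < 0, VectorCalculus.IsDivFree (v t)) (i : Fin 3)
    (hsrc : ∀ t < 0, ∀ x,
      ⟪timeDerivWithin (Iio 0) v t x + convect (v t) (v t) x - (Δ (v t)) x,
          (EuclideanSpace.single i (1 : ℝ) : EuclideanSpace ℝ (Fin 3))⟫_ℝ =
        ⟪timeDerivWithin (Iio 0) v t 0 + convect (v t) (v t) 0 - (Δ (v t)) 0,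
          (EuclideanSpace.single i (1 : ℝ) : EuclideanSpace ℝ (Fin 3))⟫_ℝ) :
    ∀ t < 0, ∀ x, v t x i = v t 0 i := by
  obtain ⟨C₁, hC₁⟩ := exists_fderiv_rate_of_class hrate hcont hmild
  have hcomp : ∀ t < 0, ∀ x,
      ⟪v t x, (EuclideanSpace.single i (1 : ℝ) : EuclideanSpace ℝ (Fin 3))⟫_ℝ =
        ⟪v t 0, (EuclideanSpace.single i (1 : ℝ) : EuclideanSpace ℝ (Fin 3))⟫_ℝ :=
    stub_decayingSlopeLiouville C v hrate hcont hmild hdiv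
      (fun t y => ⟪v t y, (EuclideanSpace.single i (1 : ℝ) : EuclideanSpace ℝ (Fin 3))⟫_ℝ)
      (fun t => ⟪timeDerivWithin (Iio 0) v t 0 + convect (v t) (v t) 0 - (Δ (v t)) 0,
        (EuclideanSpace.single i (1 : ℝ) : EuclideanSpace ℝ (Fin 3))⟫_ℝ)
      0 (fun t => C₁ / (-t))
      (contDiffOn_component hrate hcont hmild hdiv _)
      (fun t ht x => by rw [component_equation hrate hcont hmild hdiv _ ht x, hsrc t ht x])
      (fun t ht x => component_slope hrate hcont hmild hC₁ i ht x)
      (continuousOn_rate C₁) (tendsto_rate_mul_sqrt C₁)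
  intro t ht x
  simpa [EuclideanSpace.inner_single_right] using hcomp t ht x

/-! ### (2C) Two spatially constant components, no poloidality -/

/-- **TWO spatially constant components of the pressure gradient ⇒ trivial (no poloidality).**  A profile of the
route's Type-I class for which two Cartesian components `⟪f, eᵢ⟫`, `⟪f, eⱼ⟫` (`i ≠ j`) of the residual
`f = ∂ₜv + (v·∇)v − Δv` are spatially constant on every slice vanishes identically: `vᵢ`, `vⱼ` are constant on
slices (L4), `div v = 0` makes the slice `s = −1` invariant under translations along the third axis, and the
one-slice translate Liouville theorem ends. -/
theorem eq_zero_of_twoComponentSourceGauge (hrate : HasTypeITimeDecay C v)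
    (hcont : ContinuousOn (uncurry v) (Iio (0 : ℝ) ×ˢ univ))
    (hmild : ∀ s t : ℝ, s < t → t < 0 → ∀ x,
      v t x = UnboundedOperators.heatExtension (v s) (t - s) x - oseenDuhamel 1 s v v t x)
    (hdiv : ∀ t < 0, VectorCalculus.IsDivFree (v t)) {i j : Fin 3} (hij : i ≠ j)
    (hsrc_i : ∀ t < 0, ∀ x,
      ⟪timeDerivWithin (Iio 0) v t x + convect (v t) (v t) x - (Δ (v t)) x,
          (EuclideanSpace.single i (1 : ℝ) : EuclideanSpace ℝ (Fin 3))⟫_ℝ =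
        ⟪timeDerivWithin (Iio 0) v t 0 + convect (v t) (v t) 0 - (Δ (v t)) 0,
          (EuclideanSpace.single i (1 : ℝ) : EuclideanSpace ℝ (Fin 3))⟫_ℝ)
    (hsrc_j : ∀ t < 0, ∀ x,
      ⟪timeDerivWithin (Iio 0) v t x + convect (v t) (v t) x - (Δ (v t)) x,
          (EuclideanSpace.single j (1 : ℝ) : EuclideanSpace ℝ (Fin 3))⟫_ℝ =
        ⟪timeDerivWithin (Iio 0) v t 0 + convect (v t) (v t) 0 - (Δ (v t)) 0,
          (EuclideanSpace.single j (1 : ℝ) : EuclideanSpace ℝ (Fin 3))⟫_ℝ) :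
    ∀ t < 0, ∀ x, v t x = 0 := by
  have hbdd := bdd_of_hasTypeITimeDecay hrate
  have hi := slice_const_of_componentSourceGauge hrate hcont hmild hdiv i hsrc_i
  have hj := slice_const_of_componentSourceGauge hrate hcont hmild hdiv j hsrc_j
  -- the third index
  obtain ⟨k, hki, hkj⟩ := fin3_exists_third i j hij
  have hs : (-1 : ℝ) < 0 := by norm_num
  have hd : Differentiable ℝ (v (-1)) :=
    ((analyticOnNhd_slice hcont hbdd hmild hs).contDiff (n := 1)).differentiable one_ne_zero
  have hD : ∀ y, fderiv ℝ (v (-1)) y (EuclideanSpace.single k 1) = 0 := fun y =>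
    fderiv_single_eq_zero_of_two_const hd (hdiv (-1) hs) hij hki hkj (hi (-1) hs) (hj (-1) hs) y
  have hinv : ∀ (y : EuclideanSpace ℝ (Fin 3)) (l : ℝ),
      v (-1) (y + l • (EuclideanSpace.single k 1 : EuclideanSpace ℝ (Fin 3))) = v (-1) y :=
    translate_eq_of_fderiv_eq_zero hd hD
  have hne : (EuclideanSpace.single k 1 : EuclideanSpace ℝ (Fin 3)) ≠ 0 := fun h0 => by
    simpa using congrArg (fun w : EuclideanSpace ℝ (Fin 3) => w k) h0
  exact eq_zero_of_translate_eq_slice hrate hcont hmild hdiv hs hne hinv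

/-- **Two spatially constant components ⇒ not backward-singular.** -/
theorem nonflatLiouville_of_twoComponentSourceGauge (hrate : HasTypeITimeDecay C v)
    (hcont : ContinuousOn (uncurry v) (Iio (0 : ℝ) ×ˢ univ))
    (hmild : ∀ s t : ℝ, s < t → t < 0 → ∀ x,
      v t x = UnboundedOperators.heatExtension (v s) (t - s) x - oseenDuhamel 1 s v v t x)
    (hdiv : ∀ t < 0, VectorCalculus.IsDivFree (v t)) {i j : Fin 3} (hij : i ≠ j)
    (hsrc_i : ∀ t < 0, ∀ x,
      ⟪timeDerivWithin (Iio 0) v t x + convect (v t) (v t) x - (Δ (v t)) x,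
          (EuclideanSpace.single i (1 : ℝ) : EuclideanSpace ℝ (Fin 3))⟫_ℝ =
        ⟪timeDerivWithin (Iio 0) v t 0 + convect (v t) (v t) 0 - (Δ (v t)) 0,
          (EuclideanSpace.single i (1 : ℝ) : EuclideanSpace ℝ (Fin 3))⟫_ℝ)
    (hsrc_j : ∀ t < 0, ∀ x,
      ⟪timeDerivWithin (Iio 0) v t x + convect (v t) (v t) x - (Δ (v t)) x,
          (EuclideanSpace.single j (1 : ℝ) : EuclideanSpace ℝ (Fin 3))⟫_ℝ =
        ⟪timeDerivWithin (Iio 0) v t 0 + convect (v t) (v t) 0 - (Δ (v t)) 0,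
          (EuclideanSpace.single j (1 : ℝ) : EuclideanSpace ℝ (Fin 3))⟫_ℝ) :
    ¬ IsBackwardSingularPoint v 0 :=
  not_backwardSingular_of_zero (eq_zero_of_twoComponentSourceGauge hrate hcont hmild hdiv hij hsrc_i hsrc_j)

/-! ### (1H) One spatially constant HORIZONTAL component, with poloidality -/

/-- Expansion of the frozen constraint in partial derivatives: for a differentiable `V` on `ℝ³` that is poloidal
along `e₃` at `y` (`(curl V)₂ = 0`; no differentiability needed — `curl` is read off `fderiv`), `⟪DV(y)(curl V(y)), e₃⟫ = (∂₁V₂ − ∂₂V₁)·∂₀V₂ + (∂₂V₀ − ∂₀V₂)·∂₁V₂`. -/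
theorem inner_fderiv_curl_single_two {V : EuclideanSpace ℝ (Fin 3) → EuclideanSpace ℝ (Fin 3)}
    {y : EuclideanSpace ℝ (Fin 3)} (hpol : curl V y 2 = 0) :
    ⟪fderiv ℝ V y (curl V y), EuclideanSpace.single 2 1⟫_ℝ =
      (fderiv ℝ V y (EuclideanSpace.single 1 1) 2 - fderiv ℝ V y (EuclideanSpace.single 2 1) 1) *
          fderiv ℝ V y (EuclideanSpace.single 0 1) 2 +
        (fderiv ℝ V y (EuclideanSpace.single 2 1) 0 - fderiv ℝ V y (EuclideanSpace.single 0 1) 2) *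
          fderiv ℝ V y (EuclideanSpace.single 1 1) 2 := by
  -- expand `curl V y` in the standard basis
  have hω : curl V y = (curl V y 0) • (EuclideanSpace.single 0 1 : EuclideanSpace ℝ (Fin 3)) +
      (curl V y 1) • EuclideanSpace.single 1 1 + (curl V y 2) • EuclideanSpace.single 2 1 := by
    ext m
    fin_cases m <;> simp
  have h0 : curl V y 0 = fderiv ℝ V y (EuclideanSpace.single 1 1) 2 - fderiv ℝ V y (EuclideanSpace.single 2 1) 1 := by
    simp [curl]
  have h1 : curl V y 1 = fderiv ℝ V y (EuclideanSpace.single 2 1) 0 - fderiv ℝ V y (EuclideanSpace.single 0 1) 2 := by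
    simp [curl]
  rw [EuclideanSpace.inner_single_right, hω, hpol, zero_smul, add_zero, map_add, map_smul, map_smul, h0, h1]
  simp [mul_comm]

/-- **Real-analytic alternative on one slice.**  On a slice of the class two real-analytic scalar factors whose
product vanishes identically: one of them vanishes identically (identity theorem on the connected space `ℝ³`). -/
theorem eq_zero_or_eq_zero_of_mul_analytic {F G : EuclideanSpace ℝ (Fin 3) → ℝ}
    (hF : AnalyticOnNhd ℝ F univ) (hG : AnalyticOnNhd ℝ G univ) (h : ∀ y, F y * G y = 0) :
    (∀ y, F y = 0) ∨ (∀ y, G y = 0) := by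
  by_cases hFz : ∀ y, F y = 0
  · exact Or.inl hFz
  · right
    push Not at hFz
    obtain ⟨y₀, hy₀⟩ := hFz
    -- `F ≠ 0` near `y₀`, so `G = 0` near `y₀`, hence everywhere
    have hne : ∀ᶠ z in 𝓝 y₀, F z ≠ 0 :=
      (hF y₀ (mem_univ y₀)).continuousAt.eventually_ne hy₀
    have hev : G =ᶠ[𝓝 y₀] 0 := by
      filter_upwards [hne] with z hz
      have := h z
      simpa [hz] using this
    intro y
    exact hG.eqOn_zero_of_preconnected_of_eventuallyEq_zero isPreconnected_univ (mem_univ y₀) hev (mem_univ y)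

/-- The partial derivatives `(DV(·) a)ᵢ` of a real-analytic field are real-analytic. -/
theorem analyticOnNhd_fderiv_apply_coord {V : EuclideanSpace ℝ (Fin 3) → EuclideanSpace ℝ (Fin 3)}
    (hV : AnalyticOnNhd ℝ V univ) (a : EuclideanSpace ℝ (Fin 3)) (i : Fin 3) :
    AnalyticOnNhd ℝ (fun y => fderiv ℝ V y a i) univ := by
  have h1 : AnalyticOnNhd ℝ (fun y => fderiv ℝ V y a) univ :=
    (ContinuousLinearMap.apply ℝ (EuclideanSpace ℝ (Fin 3)) a).comp_analyticOnNhd hV.fderiv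
  exact (EuclideanSpace.proj (𝕜 := ℝ) i : EuclideanSpace ℝ (Fin 3) →L[ℝ] ℝ).comp_analyticOnNhd h1

/-- **ONE spatially constant HORIZONTAL component `⟪f, e₀⟫` + poloidal ⇒ trivial.**  A profile of the route's
Type-I class, poloidal along `e₃` on every slice, for which the `e₀`-component of `f = ∂ₜv + (v·∇)v − Δv`
(`= −∂₀p`) is spatially constant on every slice, vanishes identically.  L4 makes `v₀` constant on slices; with
`ω₃ ≡ 0` the frozen constraint `⟪Dv ω, e₃⟫ ≡ 0` (nsreg-p6 `stub_firstIntegral`) becomes `(∂₃v₁)(∂₀v₃) ≡ 0`; on the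
slice `s = −1` one real-analytic factor vanishes identically: `∂₀v₃ ≡ 0` is the flat stratum
(`eq_zero_of_flat_slice_single_zero`), `∂₃v₁ ≡ 0` (with `∂₃v₀ ≡ 0`) the vertically rigid stratum
(`eq_zero_of_vertRigid_slice`). -/
theorem eq_zero_of_horizontalSourceGauge_single_zero (hrate : HasTypeITimeDecay C v)
    (hcont : ContinuousOn (uncurry v) (Iio (0 : ℝ) ×ˢ univ))
    (hmild : ∀ s t : ℝ, s < t → t < 0 → ∀ x,
      v t x = UnboundedOperators.heatExtension (v s) (t - s) x - oseenDuhamel 1 s v v t x)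
    (hdiv : ∀ t < 0, VectorCalculus.IsDivFree (v t))
    (hpol : ∀ s < 0, ∀ y, ⟪curl (v s) y, EuclideanSpace.single 2 1⟫_ℝ = 0)
    (hsrc : ∀ t < 0, ∀ x,
      ⟪timeDerivWithin (Iio 0) v t x + convect (v t) (v t) x - (Δ (v t)) x,
          (EuclideanSpace.single 0 (1 : ℝ) : EuclideanSpace ℝ (Fin 3))⟫_ℝ =
        ⟪timeDerivWithin (Iio 0) v t 0 + convect (v t) (v t) 0 - (Δ (v t)) 0,
          (EuclideanSpace.single 0 (1 : ℝ) : EuclideanSpace ℝ (Fin 3))⟫_ℝ) :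
    ∀ t < 0, ∀ x, v t x = 0 := by
  have hbdd := bdd_of_hasTypeITimeDecay hrate
  have h0 := slice_const_of_componentSourceGauge hrate hcont hmild hdiv 0 hsrc
  have hs : (-1 : ℝ) < 0 := by norm_num
  have han : AnalyticOnNhd ℝ (v (-1)) univ := analyticOnNhd_slice hcont hbdd hmild hs
  have hd : Differentiable ℝ (v (-1)) := (han.contDiff (n := 1)).differentiable one_ne_zero
  -- all partial derivatives of `v₀` vanish on the slice
  have hD0 : ∀ y w, fderiv ℝ (v (-1)) y w 0 = 0 := fun y w =>
    fderiv_apply_coord_eq_zero_of_const hd (h0 (-1) hs) y w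
  have hpol2 : ∀ y, curl (v (-1)) y 2 = 0 := fun y => by
    simpa [EuclideanSpace.inner_single_right] using hpol (-1) hs y
  -- the frozen constraint ⇒ `(∂₃v₁)(∂₀v₃) ≡ 0`
  set F : EuclideanSpace ℝ (Fin 3) → ℝ := fun y => fderiv ℝ (v (-1)) y (EuclideanSpace.single 2 1) 1 with hFdef
  set G : EuclideanSpace ℝ (Fin 3) → ℝ := fun y => fderiv ℝ (v (-1)) y (EuclideanSpace.single 0 1) 2 with hGdef
  have hFG : ∀ y, F y * G y = 0 := by
    intro y
    have hfro := stub_firstIntegral C v hrate hcont hmild hdiv (EuclideanSpace.single 2 1) hpol (-1) hs y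
    rw [inner_fderiv_curl_single_two (hpol2 y), hD0 y (EuclideanSpace.single 2 1)] at hfro
    simp only [hFdef, hGdef]
    linear_combination (-1 : ℝ) * hfro
  have hF : AnalyticOnNhd ℝ F univ := analyticOnNhd_fderiv_apply_coord han _ _
  have hG : AnalyticOnNhd ℝ G univ := analyticOnNhd_fderiv_apply_coord han _ _
  rcases eq_zero_or_eq_zero_of_mul_analytic hF hG hFG with hFz | hGz
  · -- `∂₃v₁ ≡ 0` and `∂₃v₀ ≡ 0`: vertically rigid slice
    exact eq_zero_of_vertRigid_slice hrate hcont hmild hdiv hs (fun y => hD0 y _) hFz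
  · -- `∂₀v₃ ≡ 0`: flat slice
    exact eq_zero_of_flat_slice_single_zero hrate hcont hmild hdiv hs (hpol (-1) hs) hGz

/-- **ONE spatially constant HORIZONTAL component `⟪f, e₁⟫` + poloidal ⇒ trivial** (the same argument with the
horizontal indices exchanged: the frozen constraint becomes `(∂₃v₀)(∂₁v₃) ≡ 0`; `∂₁v₃ ≡ 0` is the flat stratum
along `e₁` (`eq_zero_of_flat_slice`), `∂₃v₀ ≡ 0` with `∂₃v₁ ≡ 0` the vertically rigid one). -/
theorem eq_zero_of_horizontalSourceGauge_single_one (hrate : HasTypeITimeDecay C v)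
    (hcont : ContinuousOn (uncurry v) (Iio (0 : ℝ) ×ˢ univ))
    (hmild : ∀ s t : ℝ, s < t → t < 0 → ∀ x,
      v t x = UnboundedOperators.heatExtension (v s) (t - s) x - oseenDuhamel 1 s v v t x)
    (hdiv : ∀ t < 0, VectorCalculus.IsDivFree (v t))
    (hpol : ∀ s < 0, ∀ y, ⟪curl (v s) y, EuclideanSpace.single 2 1⟫_ℝ = 0)
    (hsrc : ∀ t < 0, ∀ x,
      ⟪timeDerivWithin (Iio 0) v t x + convect (v t) (v t) x - (Δ (v t)) x,
          (EuclideanSpace.single 1 (1 : ℝ) : EuclideanSpace ℝ (Fin 3))⟫_ℝ =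
        ⟪timeDerivWithin (Iio 0) v t 0 + convect (v t) (v t) 0 - (Δ (v t)) 0,
          (EuclideanSpace.single 1 (1 : ℝ) : EuclideanSpace ℝ (Fin 3))⟫_ℝ) :
    ∀ t < 0, ∀ x, v t x = 0 := by
  have hbdd := bdd_of_hasTypeITimeDecay hrate
  have h1 := slice_const_of_componentSourceGauge hrate hcont hmild hdiv 1 hsrc
  have hs : (-1 : ℝ) < 0 := by norm_num
  have han : AnalyticOnNhd ℝ (v (-1)) univ := analyticOnNhd_slice hcont hbdd hmild hs
  have hd : Differentiable ℝ (v (-1)) := (han.contDiff (n := 1)).differentiable one_ne_zero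
  have hD1 : ∀ y w, fderiv ℝ (v (-1)) y w 1 = 0 := fun y w =>
    fderiv_apply_coord_eq_zero_of_const hd (h1 (-1) hs) y w
  have hpol2 : ∀ y, curl (v (-1)) y 2 = 0 := fun y => by
    simpa [EuclideanSpace.inner_single_right] using hpol (-1) hs y
  -- the frozen constraint ⇒ `(∂₃v₀)(∂₁v₃) ≡ 0`
  set F : EuclideanSpace ℝ (Fin 3) → ℝ := fun y => fderiv ℝ (v (-1)) y (EuclideanSpace.single 2 1) 0 with hFdef
  set G : EuclideanSpace ℝ (Fin 3) → ℝ := fun y => fderiv ℝ (v (-1)) y (EuclideanSpace.single 1 1) 2 with hGdef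
  have hFG : ∀ y, F y * G y = 0 := by
    intro y
    have hfro := stub_firstIntegral C v hrate hcont hmild hdiv (EuclideanSpace.single 2 1) hpol (-1) hs y
    rw [inner_fderiv_curl_single_two (hpol2 y), hD1 y (EuclideanSpace.single 2 1)] at hfro
    simp only [hFdef, hGdef]
    linear_combination hfro
  have hF : AnalyticOnNhd ℝ F univ := analyticOnNhd_fderiv_apply_coord han _ _
  have hG : AnalyticOnNhd ℝ G univ := analyticOnNhd_fderiv_apply_coord han _ _
  rcases eq_zero_or_eq_zero_of_mul_analytic hF hG hFG with hFz | hGz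
  · -- `∂₃v₀ ≡ 0` and `∂₃v₁ ≡ 0`: vertically rigid slice
    exact eq_zero_of_vertRigid_slice hrate hcont hmild hdiv hs hFz (fun y => hD1 y _)
  · -- `∂₁v₃ ≡ 0`: flat slice along `e₁`
    have hne : (EuclideanSpace.single 1 1 : EuclideanSpace ℝ (Fin 3)) ≠ 0 := fun h0 => by
      simpa using congrArg (fun w : EuclideanSpace ℝ (Fin 3) => w 1) h0
    have h13 : ⟪(EuclideanSpace.single 1 1 : EuclideanSpace ℝ (Fin 3)), EuclideanSpace.single 2 1⟫_ℝ = 0 := by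
      simp [EuclideanSpace.inner_single_left]
    refine eq_zero_of_flat_slice hrate hcont hmild hdiv hs (hpol (-1) hs) hne h13 fun y => ?_
    simpa [EuclideanSpace.inner_single_right] using hGz y

/-- **One spatially constant horizontal component (`e₀`) + poloidal ⇒ not backward-singular.** -/
theorem nonflatLiouville_of_horizontalSourceGauge_single_zero (hrate : HasTypeITimeDecay C v)
    (hcont : ContinuousOn (uncurry v) (Iio (0 : ℝ) ×ˢ univ))
    (hmild : ∀ s t : ℝ, s < t → t < 0 → ∀ x,
      v t x = UnboundedOperators.heatExtension (v s) (t - s) x - oseenDuhamel 1 s v v t x)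
    (hdiv : ∀ t < 0, VectorCalculus.IsDivFree (v t))
    (hpol : ∀ s < 0, ∀ y, ⟪curl (v s) y, EuclideanSpace.single 2 1⟫_ℝ = 0)
    (hsrc : ∀ t < 0, ∀ x,
      ⟪timeDerivWithin (Iio 0) v t x + convect (v t) (v t) x - (Δ (v t)) x,
          (EuclideanSpace.single 0 (1 : ℝ) : EuclideanSpace ℝ (Fin 3))⟫_ℝ =
        ⟪timeDerivWithin (Iio 0) v t 0 + convect (v t) (v t) 0 - (Δ (v t)) 0,
          (EuclideanSpace.single 0 (1 : ℝ) : EuclideanSpace ℝ (Fin 3))⟫_ℝ) :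
    ¬ IsBackwardSingularPoint v 0 :=
  not_backwardSingular_of_zero (eq_zero_of_horizontalSourceGauge_single_zero hrate hcont hmild hdiv hpol hsrc)

/-- **One spatially constant horizontal component (`e₁`) + poloidal ⇒ not backward-singular.** -/
theorem nonflatLiouville_of_horizontalSourceGauge_single_one (hrate : HasTypeITimeDecay C v)
    (hcont : ContinuousOn (uncurry v) (Iio (0 : ℝ) ×ˢ univ))
    (hmild : ∀ s t : ℝ, s < t → t < 0 → ∀ x,
      v t x = UnboundedOperators.heatExtension (v s) (t - s) x - oseenDuhamel 1 s v v t x)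
    (hdiv : ∀ t < 0, VectorCalculus.IsDivFree (v t))
    (hpol : ∀ s < 0, ∀ y, ⟪curl (v s) y, EuclideanSpace.single 2 1⟫_ℝ = 0)
    (hsrc : ∀ t < 0, ∀ x,
      ⟪timeDerivWithin (Iio 0) v t x + convect (v t) (v t) x - (Δ (v t)) x,
          (EuclideanSpace.single 1 (1 : ℝ) : EuclideanSpace ℝ (Fin 3))⟫_ℝ =
        ⟪timeDerivWithin (Iio 0) v t 0 + convect (v t) (v t) 0 - (Δ (v t)) 0,
          (EuclideanSpace.single 1 (1 : ℝ) : EuclideanSpace ℝ (Fin 3))⟫_ℝ) :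
    ¬ IsBackwardSingularPoint v 0 :=
  not_backwardSingular_of_zero (eq_zero_of_horizontalSourceGauge_single_one hrate hcont hmild hdiv hpol hsrc)

end Summit.NavierStokesRegularity.NavierStokesRegularity.Theorems.PoloidalWindowDoorPoloidalWindowRigidityHorizontalSourceGauge

end
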